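import Literature.NumberTheory.EllipticCurves.Castella2018.AnticyclotomicSelmerDual
import Literature.NumberTheory.EllipticCurves.PadicFormalLogOrder
import Literature.NumberTheory.EllipticCurves.Rank1Residual.Predicates
import Literature.NumberTheory.EllipticCurves.HeegnerPoints
import Literature.NumberTheory.EllipticCurves.Sha
import Literature.NumberTheory.EllipticCurves.BSDConductor
import HarnessLib

/-!
# Castella–Grossi–Lee–Skinner 2022, Thm. 5.1.1: the ANTICYCLOTOMIC CONTROL THEOREM in the reducible
# setting (`E(ℚ_p)[p] = 0` in place of irreducibility), a named fact ON THE LITERATURE OBJECT `X_ac`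

HONEST FRAMING (cell `b2b-bsdres`, run/shared/lean/b2b/bsd-rank1-residual/; page 1 everywhere):
the goal of the cell is to DELETE the COMBINATION-SHAPED residual classes of the BSD formula for ALL
analytic-rank `≤ 1` curves over `ℚ` from PUBLISHED theorems only, so that the remainder becomes
exactly the CONSTRUCTION-SHAPED classes, which are TYPED, not attempted; this is not "finishing
BSD". This file vendors ONE published statement as a named fact (`def … : Prop`, nothing asserted;
D-0014/D-0026) and PROVES its bookkeeping consumers. Unit `b2b-bsdres-lit-cgls` (off-peak
literature typer, source = Castella–Grossi–Lee–Skinner 2022 and Greenberg–Vatsal 2000), session 5.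

## What and why

The covered rank-one row C6 of the cell rests, at main-conjecture level, on the display (5.5) of the
proof of CGLS Thm. 5.3.1 (registry A157, `display55_sha_heegnerIndex`), which CGLS derive from three
numbered theorems — Thm. 4.2.2 (the Iwasawa–Greenberg / BDP main conjecture for `𝔛_E`), **Thm. 5.1.1
(anticyclotomic control)** and Thm. 5.1.3 (the BDP formula) — all statements about ONE `Λ`-module
`𝔛_E`. Until this session that module had no Literature home (it was constructed under `Summits/`,
sub-cell multr1), so none of the three could be a Literature named fact; the cell carried their
SHAPES as Summits-side predicates (`X11b.ControlOnTreeAt`, `X11b.ControlOnTreeGoodAt`, …, consumed as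
hypotheses `hCTL`/`hLC`). The module now lives in Literature
(`Castella2018/AnticyclotomicSelmer{,Dual}.lean`: `AcSelmer.XAc`, `AcSelmer.XAc.HasCharValuationAt`),
and this file vendors the first of the three theorems ON IT, verbatim. The Summits twins being
definitionally equal to the Literature objects, `X11b.ControlOnTreeGoodAt` at a reducible good
ordinary `p` is now FED by a published fact (adapter in `Summits/…/Partition/`).

## Citation header (read by this seat on the arXiv TeX source of v2 = the FINAL arXiv version,
## 2021-09-14, "Final version, to appear in Invent. Math." = the version of record's text; kept at
## `HOME/b2b-bsdres-lit-cgls/src/cgls22-v2final/Eisenstein.tex`, SHA256SUMS alongside)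

* Authors: Francesc Castella, Giada Grossi, Jaehoon Lee, Christopher Skinner.
* Title: *On the anticyclotomic Iwasawa theory of rational elliptic curves at Eisenstein primes*.
* Venue: Invent. Math. **227** (2022) 517–580, doi:10.1007/s00222-021-01072-y = arXiv:2008.02571v2
  (bib key `CastellaGrossiLeeSkinner2022`). REFEREED / PUBLISHED.
* Statement: **Theorem 5.1.1** (TeX label `controlthm`, L2403–L2424), §5.1.1 "Anticyclotomic control
  theorem" (the store's LaTeXML text `paper:arxiv-2008.02571` is v1, where the first hypothesis
  reads `E(K)[p] = 0`; v2 = final replaces it by `E(ℚ_p)[p] = 0`, see the proof sentence below).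
* Numbering (v2 TeX = journal): the Introduction is `\section*` (unnumbered), so §1 = "Algebraic
  side" (L475; 𝔛_E in §1.4 "Selmer groups of `E`", L806), §2 = "Analytic side" (Thm. 2.1.1 = the
  BDP `p`-adic `L`-function, so cited by Castella–Grossi–Skinner, Math. Ann. 2025), §3 = the
  Kolyvagin system argument, §4 = proof of Thm. C / Cor. D, §5 = proof of Thms. E / F (Thm. 5.1.1 in
  §5.1). An earlier revision of this docstring wrote "§2 / §2.3" for the §1 / §1.4 locators below
  (doc nit `CGLS-511-section-numbering`, lit-cgls session 6); the TeX line numbers were always correct.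
* Setting in force (verbatim): §1 ("Algebraic side", preamble), L479–L487: "Throughout, we fix a
  prime `p > 2` and an embedding `ι_p : ℚ̄ ↪ ℚ̄_p`, and let `K ⊂ ℚ̄` be an imaginary quadratic
  field in which `p = v v̄` splits,
  with `v` the prime of `K` above `p` induced by `ι_p`. … Let `Γ = Gal(K_∞/K)` be the Galois group
  of the anticyclotomic `ℤ_p`-extension `K_∞` of `K`, and let `Λ = ℤ_p⟦Γ⟧` be the anticyclotomic
  Iwasawa algebra. We shall often identify `Λ` with the power series ring `ℤ_p⟦T⟧` by setting
  `T = γ − 1` for a fixed topological generator `γ ∈ Γ`." §1.4 ("Selmer groups of `E`"),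
  L809–L857: "Fix a finite set `Σ` of places of `K` containing `∞` and the primes above `Np`, and
  such that the finite places in `Σ`
  are all split in `K`. … `H¹_{𝓕_Gr}(K, M_E) := ker{ H¹(K^Σ/K, M_E) → ∏_{w∈Σ, w∤p} H¹(K_w, M_E) ×
  H¹(K_v̄, M_E) }` … `𝔛_E := H¹_{𝓕_Gr}(K, M_E)^∨`" (`E/ℚ` of conductor `N`; `M_E = T ⊗ Λ^∨` with
  `G_K` acting by `ρ ⊗ Ψ⁻¹`, L496–L498; Intro L195, L216: `p` an odd prime of good (ordinary)
  reduction). §5.1.1, L2393: "Assume that `p = v v̄` splits in `K`".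
* Verbatim statement (L2403–L2424): "**Theorem 5.1.1.** Assume that • `E(ℚ_p)[p] = 0`,
  • `rank_ℤ E(K) = 1`, • `#Ш(E/K)[p^∞] < ∞`. Then `𝔛_E` is a torsion `Λ`-module, and letting
  `𝓕_E ∈ Λ` be a generator of `char_Λ(𝔛_E)`, we have
  `#ℤ_p/𝓕_E(0) = #Ш(E/K)[p^∞] · ( #(ℤ_p/((1−a_p+p)/p)·log_{ω_E} P) / [E(K):ℤ·P]_p )² ·
  ∏_{w∣N} c_w(E/K)_p`, where • `P ∈ E(K)` is any point of infinite order, • `log_{ω_E} :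
  E(K_v)_{/tors} → ℤ_p` is the formal group logarithm associated to a Néron differential `ω_E`,
  • `[E(K):ℤ·P]_p` denotes the `p`-part of the index `[E(K):ℤ·P]`, • `c_w(E/K)_p` is the `p`-part
  of the Tamagawa number of `E/K_w`."
* Its printed proof (L2426–L2429): "This follows from the combination of Theorem 3.3.1 and equation
  (3.5.d) in [JSW], noting that the arguments in the proof of those results apply without change
  with the `G_K`-irreducibility of `E[p]` assumed in loc. cit. replaced by the weaker hypothesis
  that `E(K)[p] = 0`, which is implied by the hypothesis `E(ℚ_p)[p] = 0` since `p` splits in `K`."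
  ([JSW] = Jetchev–Skinner–Wan, Camb. J. Math. 5 (2017), Thm. 3.3.1, (3.5.d).)

## Transcription (tree vocabulary; every symbol a Literature object)

* "`E/ℚ`, `p > 2` of good ordinary reduction" = a globally minimal `W` (so `a_p = W.frobeniusTrace p`
  and `ω = dx/(2y + a₁x + a₃)` is a Néron differential), `2 < p`, `Rank1Residual.GoodOrd W p`.
* "`K` imaginary quadratic, `p = v v̄` splits" = `IsImaginaryQuadratic K`,
  `SatisfiesHeegnerHypothesis p K`; the §1.4 setting "`Σ ⊇` primes above `Np`, finite places of `Σ`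
  split" = `SatisfiesHeegnerHypothesis (W.conductorNorm ℤ) K` (every `ℓ ∣ N` splits in `K`).
* "`ι_p`, `v` the prime induced by `ι_p`" = an embedding `ι : K →+* ℚ_[p]` and the prime `v` with
  `x ∈ v ⟺ ‖ι x‖ < 1` on `𝓞 K`; "`v̄`" = the other prime `vbar ∋ p`, `vbar ≠ v`.
* "`K_∞`, `γ`, `Λ = ℤ_p⟦T⟧`, `T = γ − 1`" = an anticyclotomic `κ : ZpExtension K p`
  (`κ.IsAnticyclotomic`), a topological generator `γ` (`[Fact (κ.IsTopGenerator γ)]`),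
  `IwasawaAlgebra p`.
* "`𝔛_E`" = `AcSelmer.XAc (W.baseChange K) p κ vbar ∅ γ` — Castella 2018's `X_ac(E[p^∞])` with
  Castella's strict prime `𝔭 = v̄` and `Σ = ∅`, in the `K_∞`-formulation (Shapiro;
  `Castella2018/AnticyclotomicSelmer.lean`): strict above `v̄`, relaxed above `v`, locally trivial
  above every finite `w ∤ p` — the READING of `H¹_{𝓕_Gr}(K, M_E)^∨` used by the whole cell
  (sub-cells multr1, lit-glue), see the caveats recorded there (the `K^Σ/K` condition at the inert
  `w ∤ Np` is "unramified", which for the divisible `E[p^∞]` at a good `w` equals "trivial").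
* "`E(ℚ_p)[p] = 0`" = `∀ Q ∈ E(ℚ_p), p • Q = 0 → Q = 0` on `W.baseChange ℚ_[p]`;
  "`rank_ℤ E(K) = 1`" = `(W.baseChange K).mordellWeilRank = 1`; "`#Ш(E/K)[p^∞] < ∞`" =
  `Finite (AddCommGroup.primaryComponent (W.baseChange K).sha p)`; "`P` of infinite order" =
  `¬ IsOfFinAddOrder P`.
* Conclusion, with `#ℤ_p/(x) = p^{ord_p x}`: `𝔛_E` is `Λ`-torsion, `char_Λ(𝔛_E) = (𝓕)` for some
  `𝓕` with `𝓕(0) ≠ 0`, and `ord_p 𝓕(0) = ord_p #Ш(E/K)[p^∞] + 2·((ord_p(1−a_p+p) − 1 +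
  ord_p log_{ω_E} P) − ord_p [E(K):ℤ·P]) + ord_p ∏_w c_w(E/K)`, where `ord_p log_{ω_E} P =
  padicLogOrd W p ι P` (the formal logarithm at `K_v = ℚ_p` along `ι`, `PadicFormalLogOrder.lean`),
  `[E(K):ℤ·P] = (AddSubgroup.zmultiples P).index`, and `∏_{w∣N} c_w(E/K)` is transcribed as the
  tree's full Tamagawa product of `E/K` (`(W.baseChange K).tamagawaProduct`; `c_w = 1` off `N`) —
  the reading already used for A157 / JSW (eq:shalowerK-1) / Castella (5.3) in the cell. "Letting
  `𝓕_E` be a generator" is read as the existence of such a generator; that EVERY generator then has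
  the same `ord_p 𝓕(0)` is PROVED below (`thm511_padicVal_eq_of_generator`).

## Contents

* `thm511_anticyclotomicControl` — the named fact (ONE new `def … : Prop`).
* PROVED: `hasCharValuationAt_of_thm511` (the fact in the packaged currency
  `AcSelmer.XAc.HasCharValuationAt … n ∧ n = …` — LITERALLY the body shape of the Summits predicate
  `X11b.ControlOnTreeGoodAt`, up to the Tamagawa reading), `thm511_padicVal_eq_of_generator` (every
  generator of `char_Λ(𝔛_E)` has the printed `ord_p 𝓕(0)`), `two_mul_logOrd_sub_index_eq_of_thm511`
  (two points of infinite order give the same `ord_p log P − ord_p [E(K):ℤP]` — the internal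
  consistency of the printed formula, from `HasCharValuationAt.unique`).

## References
* [CastellaGrossiLeeSkinner2022] Invent. Math. 227 (2022) = arXiv:2008.02571v2: Thm. 5.1.1 and
  proof; §1 (setting), §1.4 (`𝔛_E`).
* [JetchevSkinnerWan2017] Camb. J. Math. 5 (2017): Thm. 3.3.1, §3.5 (3.5.d) — the source theorem.
* [Castella2018] Camb. J. Math. 6 (2018): Def. 2.2, Thm. 2.3 — the object and the same control
  theorem with `ε_p`; Literature object `Castella2018/AnticyclotomicSelmer{,Dual}.lean`.
* HOME/CITED-FACTS.md A157 (display (5.5)); HOME/b2b-bsdres-lit-cgls/CGLS-GV-TYPING.md §6 (S1/S2),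
  §12 (session 5); HOME/b2b-bsdres-lit-glue/GLUE.md §G3.4 (A1′).
-/

set_option autoImplicit false

noncomputable section

open scoped Classical

open WeierstrassCurve NumberField IsDedekindDomain Field Literature.NumberTheory.EllipticCurves
  Literature.NumberTheory.EllipticCurves.Rank1Residual
  Literature.NumberTheory.EllipticCurves.Castella2018

namespace Literature.NumberTheory.EllipticCurves.CastellaGrossiLeeSkinner2022

/-- **Castella–Grossi–Lee–Skinner, Invent. Math. 227 (2022) = arXiv:2008.02571v2 (final),
Theorem 5.1.1 (anticyclotomic control theorem, §5.1.1).** Setting (§1, §1.4, §5.1.1, verbatim):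
"we fix a prime `p > 2` and an embedding `ι_p : ℚ̄ ↪ ℚ̄_p`, and let `K ⊂ ℚ̄` be an imaginary quadratic
field in which `p = v v̄` splits, with `v` the prime of `K` above `p` induced by `ι_p` … `Γ =
Gal(K_∞/K)` the Galois group of the anticyclotomic `ℤ_p`-extension … `Λ = ℤ_p⟦Γ⟧` … `ℤ_p⟦T⟧` by
setting `T = γ − 1` for a fixed topological generator `γ`"; `E/ℚ` of conductor `N`, `p` of good
ordinary reduction; `Σ ⊇` the primes above `Np` with all finite places of `Σ` split in `K`;
`𝔛_E := H¹_{𝓕_Gr}(K, M_E)^∨` (strict at `v̄`, relaxed at `v`). Statement (verbatim): "Assume that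
• `E(ℚ_p)[p] = 0`, • `rank_ℤ E(K) = 1`, • `#Ш(E/K)[p^∞] < ∞`. Then `𝔛_E` is a torsion `Λ`-module,
and letting `𝓕_E ∈ Λ` be a generator of `char_Λ(𝔛_E)`, we have `#ℤ_p/𝓕_E(0) = #Ш(E/K)[p^∞] ·
( #(ℤ_p/((1−a_p+p)/p)·log_{ω_E} P) / [E(K):ℤ·P]_p )² · ∏_{w∣N} c_w(E/K)_p`, where `P ∈ E(K)` is any
point of infinite order, `log_{ω_E} : E(K_v)_{/tors} → ℤ_p` is the formal group logarithm associated
to a Néron differential `ω_E`, `[E(K):ℤ·P]_p` denotes the `p`-part of the index `[E(K):ℤ·P]`,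
`c_w(E/K)_p` is the `p`-part of the Tamagawa number of `E/K_w`" (proof: "the combination of
Theorem 3.3.1 and equation (3.5.d) in [JSW] … with the `G_K`-irreducibility of `E[p]` … replaced by
the weaker hypothesis that `E(K)[p] = 0`, which is implied by the hypothesis `E(ℚ_p)[p] = 0` since
`p` splits in `K`"). TRANSCRIBED (module docstring for the dictionary): `W` globally minimal,
`2 < p`, `GoodOrd W p`; `K` imaginary quadratic with `p` split and every `ℓ ∣ N` split; `ι : K →+*
ℚ_p`, `v` the prime induced by `ι`, `vbar ∋ p` the other one; `κ` anticyclotomic with topological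
generator `γ`; `𝔛_E = AcSelmer.XAc (W.baseChange K) p κ vbar ∅ γ` (the Literature object of
`Castella2018/AnticyclotomicSelmerDual.lean`, `K_∞`-formulation); conclusion with
`#ℤ_p/(x) = p^{ord_p x}`: torsion, `char = (𝓕)`, `𝓕(0) ≠ 0`, `ord_p 𝓕(0) = ord_p #Ш(E/K)[p^∞] +
2·((ord_p(1−a_p+p) − 1 + ord_p log_{ω_E} P) − ord_p[E(K):ℤP]) + ord_p ∏_w c_w(E/K)`
(`padicLogOrd W p ι P`; `(W.baseChange K).tamagawaProduct`, `c_w = 1` off `N`). PUBLISHED.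
[cite: CastellaGrossiLeeSkinner2022, Thm. 5.1.1 (§5.1.1; arXiv v2 TeX L2403–L2429) with §1 (L479–L487) and §1.4 (L809–L857)]
[cite: JetchevSkinnerWan2017, Thm. 3.3.1 and (3.5.d) (the source of the printed proof)]
[cite: Castella2018, Def. 2.2 and Thm. 2.3 (arXiv:1704.06608 p. 5) (the object `X_ac`; same theorem with `ε_p`)] -/
def thm511_anticyclotomicControl : Prop :=
  ∀ (W : WeierstrassCurve ℚ) [W.IsElliptic] [W.IsGloballyMinimal] (p : ℕ) [Fact p.Prime],
    2 < p → GoodOrd W p →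
    ∀ (K : Type) [Field K] [NumberField K], IsImaginaryQuadratic K →
      SatisfiesHeegnerHypothesis p K → SatisfiesHeegnerHypothesis (W.conductorNorm ℤ) K →
    ∀ (ι : K →+* ℚ_[p]) (v vbar : HeightOneSpectrum (𝓞 K)),
      (∀ x : 𝓞 K, x ∈ v.asIdeal ↔ ‖ι (x : K)‖ < 1) →
      ((p : ℕ) : 𝓞 K) ∈ vbar.asIdeal → vbar ≠ v →
    ∀ (κ : ZpExtension K p), κ.IsAnticyclotomic →
    ∀ (γ : absoluteGaloisGroup K) [Fact (κ.IsTopGenerator γ)],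
      (∀ Q : (W.baseChange ℚ_[p]).toAffine.Point, p • Q = 0 → Q = 0) →
      (W.baseChange K).mordellWeilRank = 1 →
      Finite (AddCommGroup.primaryComponent (W.baseChange K).sha p) →
    ∀ (P : (W.baseChange K).toAffine.Point), ¬ IsOfFinAddOrder P →
      Module.IsTorsion (IwasawaAlgebra p) (AcSelmer.XAc (W.baseChange K) p κ vbar ∅ γ) ∧
      ∃ F : IwasawaAlgebra p,
        AcSelmer.XAc.charIdeal (W.baseChange K) p κ vbar ∅ γ = Ideal.span {F} ∧
        PowerSeries.constantCoeff F ≠ 0 ∧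
        ((PowerSeries.constantCoeff F).valuation : ℤ) =
          (padicValNat p (Nat.card (AddCommGroup.primaryComponent (W.baseChange K).sha p)) : ℤ) +
            2 * (((padicValInt p (1 - W.frobeniusTrace p + p) : ℤ) - 1 + padicLogOrd W p ι P) -
              (padicValNat p (AddSubgroup.zmultiples P).index : ℤ)) +
            (padicValNat p (W.baseChange K).tamagawaProduct : ℤ)

variable {W : WeierstrassCurve ℚ} [W.IsElliptic] [W.IsGloballyMinimal] {p : ℕ} [Fact p.Prime]

/-! ### Bookkeeping consumers -/

/-- **Thm. 5.1.1 in the packaged currency** `AcSelmer.XAc.HasCharValuationAt … n` ("`𝔛_E` is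
`Λ`-torsion with a generator `𝓕`, `𝓕(0) ≠ 0`, `ord_p 𝓕(0) = n`") `∧ n =` the printed right-hand
side — literally the body shape of the cell's Summits-side predicate `X11b.ControlOnTreeGoodAt`
(Castella 2018 Thm. 2.3 with `ε_p = p⁻¹`), up to the Tamagawa reading (`∏_w c_w(E/K)` here,
`∏_{w∣N⁺} c_w` there; equal at a field where every `ℓ ∣ N` splits).
[cite: CastellaGrossiLeeSkinner2022, Thm. 5.1.1] [cite: Castella2018, Thm. 2.3 (arXiv:1704.06608 p. 5)] -/
theorem hasCharValuationAt_of_thm511 (h : thm511_anticyclotomicControl) (hp : 2 < p)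
    (hord : GoodOrd W p) (K : Type) [Field K] [NumberField K] (hK : IsImaginaryQuadratic K)
    (hHp : SatisfiesHeegnerHypothesis p K) (hHN : SatisfiesHeegnerHypothesis (W.conductorNorm ℤ) K)
    (ι : K →+* ℚ_[p]) (v vbar : HeightOneSpectrum (𝓞 K))
    (hv : ∀ x : 𝓞 K, x ∈ v.asIdeal ↔ ‖ι (x : K)‖ < 1)
    (hvbar : ((p : ℕ) : 𝓞 K) ∈ vbar.asIdeal) (hne : vbar ≠ v)
    (κ : ZpExtension K p) (hκ : κ.IsAnticyclotomic)
    (γ : absoluteGaloisGroup K) [Fact (κ.IsTopGenerator γ)]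
    (hEp : ∀ Q : (W.baseChange ℚ_[p]).toAffine.Point, p • Q = 0 → Q = 0)
    (hrk : (W.baseChange K).mordellWeilRank = 1)
    (hfin : Finite (AddCommGroup.primaryComponent (W.baseChange K).sha p))
    (P : (W.baseChange K).toAffine.Point) (hP : ¬ IsOfFinAddOrder P) :
    ∃ n : ℕ, AcSelmer.XAc.HasCharValuationAt (W.baseChange K) p κ vbar ∅ γ n ∧
      (n : ℤ) = (padicValNat p (Nat.card (AddCommGroup.primaryComponent (W.baseChange K).sha p)) : ℤ) +
        2 * (((padicValInt p (1 - W.frobeniusTrace p + p) : ℤ) - 1 + padicLogOrd W p ι P) -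
          (padicValNat p (AddSubgroup.zmultiples P).index : ℤ)) +
        (padicValNat p (W.baseChange K).tamagawaProduct : ℤ) := by
  obtain ⟨htors, F, hF, hF0, hval⟩ :=
    h W p hp hord K hK hHp hHN ι v vbar hv hvbar hne κ hκ γ hEp hrk hfin P hP
  exact ⟨(PowerSeries.constantCoeff F).valuation,
    AcSelmer.XAc.hasCharValuationAt_of_eq htors hF hF0 rfl, hval⟩

/-- **Every generator has the printed valuation**: granted Thm. 5.1.1, if `char_Λ(𝔛_E) = (𝓖)` for ANY
`𝓖 ∈ Λ`, then `𝓖(0) ≠ 0` and `ord_p 𝓖(0)` equals the printed right-hand side ("letting `𝓕_E` be a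
generator" is generator-independent: two generators differ by a unit of `Λ`, whose constant term is
a unit of `ℤ_p` — `AcSelmer.valuation_constantCoeff_eq_of_span_singleton_eq`).
[cite: CastellaGrossiLeeSkinner2022, Thm. 5.1.1] -/
theorem thm511_padicVal_eq_of_generator (h : thm511_anticyclotomicControl) (hp : 2 < p)
    (hord : GoodOrd W p) (K : Type) [Field K] [NumberField K] (hK : IsImaginaryQuadratic K)
    (hHp : SatisfiesHeegnerHypothesis p K) (hHN : SatisfiesHeegnerHypothesis (W.conductorNorm ℤ) K)
    (ι : K →+* ℚ_[p]) (v vbar : HeightOneSpectrum (𝓞 K))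
    (hv : ∀ x : 𝓞 K, x ∈ v.asIdeal ↔ ‖ι (x : K)‖ < 1)
    (hvbar : ((p : ℕ) : 𝓞 K) ∈ vbar.asIdeal) (hne : vbar ≠ v)
    (κ : ZpExtension K p) (hκ : κ.IsAnticyclotomic)
    (γ : absoluteGaloisGroup K) [Fact (κ.IsTopGenerator γ)]
    (hEp : ∀ Q : (W.baseChange ℚ_[p]).toAffine.Point, p • Q = 0 → Q = 0)
    (hrk : (W.baseChange K).mordellWeilRank = 1)
    (hfin : Finite (AddCommGroup.primaryComponent (W.baseChange K).sha p))
    (P : (W.baseChange K).toAffine.Point) (hP : ¬ IsOfFinAddOrder P)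
    (G : IwasawaAlgebra p) (hG : AcSelmer.XAc.charIdeal (W.baseChange K) p κ vbar ∅ γ = Ideal.span {G}) :
    PowerSeries.constantCoeff G ≠ 0 ∧
      ((PowerSeries.constantCoeff G).valuation : ℤ) =
        (padicValNat p (Nat.card (AddCommGroup.primaryComponent (W.baseChange K).sha p)) : ℤ) +
          2 * (((padicValInt p (1 - W.frobeniusTrace p + p) : ℤ) - 1 + padicLogOrd W p ι P) -
            (padicValNat p (AddSubgroup.zmultiples P).index : ℤ)) +
          (padicValNat p (W.baseChange K).tamagawaProduct : ℤ) := by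
  obtain ⟨-, F, hF, hF0, hval⟩ :=
    h W p hp hord K hK hHp hHN ι v vbar hv hvbar hne κ hκ γ hEp hrk hfin P hP
  obtain ⟨hG0, hGF⟩ := AcSelmer.valuation_constantCoeff_eq_of_span_singleton_eq (hF.symm.trans hG) hF0
  exact ⟨hG0, by rw [hGF]; exact hval⟩

/-- **Internal consistency of the printed formula: the point `P` is arbitrary.** Granted Thm. 5.1.1,
for two points `P, P'` of infinite order `ord_p log_{ω_E} P − ord_p[E(K):ℤP] = ord_p log_{ω_E} P' −
ord_p[E(K):ℤP']` (the two instances describe the same number `ord_p 𝓕_E(0)`,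
`AcSelmer.XAc.HasCharValuationAt.unique`) — the trace, in valuations, of "`log_{ω_E}` is a
homomorphism on `E(K) ⊗ ℤ_p ≅ ℤ_p ⊕ (torsion)`". [cite: CastellaGrossiLeeSkinner2022, Thm. 5.1.1 ("`P ∈ E(K)` is any point of infinite order")] -/
theorem logOrd_sub_index_eq_of_thm511 (h : thm511_anticyclotomicControl) (hp : 2 < p)
    (hord : GoodOrd W p) (K : Type) [Field K] [NumberField K] (hK : IsImaginaryQuadratic K)
    (hHp : SatisfiesHeegnerHypothesis p K) (hHN : SatisfiesHeegnerHypothesis (W.conductorNorm ℤ) K)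
    (ι : K →+* ℚ_[p]) (v vbar : HeightOneSpectrum (𝓞 K))
    (hv : ∀ x : 𝓞 K, x ∈ v.asIdeal ↔ ‖ι (x : K)‖ < 1)
    (hvbar : ((p : ℕ) : 𝓞 K) ∈ vbar.asIdeal) (hne : vbar ≠ v)
    (κ : ZpExtension K p) (hκ : κ.IsAnticyclotomic)
    (γ : absoluteGaloisGroup K) [Fact (κ.IsTopGenerator γ)]
    (hEp : ∀ Q : (W.baseChange ℚ_[p]).toAffine.Point, p • Q = 0 → Q = 0)
    (hrk : (W.baseChange K).mordellWeilRank = 1)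
    (hfin : Finite (AddCommGroup.primaryComponent (W.baseChange K).sha p))
    (P P' : (W.baseChange K).toAffine.Point) (hP : ¬ IsOfFinAddOrder P) (hP' : ¬ IsOfFinAddOrder P') :
    padicLogOrd W p ι P - (padicValNat p (AddSubgroup.zmultiples P).index : ℤ) =
      padicLogOrd W p ι P' - (padicValNat p (AddSubgroup.zmultiples P').index : ℤ) := by
  obtain ⟨n, hn, hne1⟩ :=
    hasCharValuationAt_of_thm511 h hp hord K hK hHp hHN ι v vbar hv hvbar hne κ hκ γ hEp hrk hfin P hP
  obtain ⟨n', hn', hne2⟩ :=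
    hasCharValuationAt_of_thm511 h hp hord K hK hHp hHN ι v vbar hv hvbar hne κ hκ γ hEp hrk hfin P' hP'
  obtain rfl : n = n' := hn.unique hn'
  omega

end Literature.NumberTheory.EllipticCurves.CastellaGrossiLeeSkinner2022

end
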